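import Mathlib
import HarnessLib
import Summits.Langlands.Langlands.Theses.FifteenLocusEisenstein
import Literature.FieldTheory.AlgClosed.PadicAlgClEquivComplex

/-!
# Birth skeleton (BC3) for crux stmt-Langlands-16056
`Summit.Langlands.Langlands.Theses.FifteenLocusEisenstein.OrientedOrdinaryOfEngine` — line `birth`

Route `route-Langlands-FifteenLocusEisenstein` (crux #5, rank 5, difficulty M).  The crux: GIVEN the
imported engine `ReducibleOrdinaryModular` (Skinner–Wiles Theorem A over an imaginary quadratic field,
staffed on route `SkinnerWilesDefectOne`), every integral Weierstrass model `E/𝓞_F` (`Δ ≠ 0`, no geometric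
CM) over an imaginary quadratic `F` that admits a Skinner–Wiles datum at an odd prime `p` — an IRREDUCIBLE
TATE FRAME `ρ : Γ_F → GL₂(ℚ̄_p)` (irreducible, unramified a.e., Frobenius characteristic polynomial
`X² − a_w(E) X + N w` a.e.) with a residually upper-triangular integral model `ρ₀` over the valuation ring,
`p`-distinguished and ORIENTED ordinary of weight `2` (one common `m > 0`) at every `v ∣ p` — is modular in
POINT-COUNT form: for every level witness `hcpt` an L-algebraic cuspidal `π` on `GL₂(𝔸_F)` with
`Σ_j α_j⁻¹ = a_w(E)` and `Π_j α_j⁻¹ = N w` at almost every `w`.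

The line (the crux's own proof plan, and the grounder's candidate `Cand16056.lean`): feed `(ρ, ρ₀)` to the
engine with `k = 2` and ANY field isomorphism `ι : ℚ̄_p ≃+* ℂ` (Steinitz — the tree's PROVED
`PadicAlgCl.nonempty_ringEquiv_complex`, imported, not stubbed); the engine returns `π` with
`SatakeFrobCompatibleAt ι π ρ w` for cofinitely many `w`, i.e. a Satake parameter `α` at `w` whose
L-normalised Frobenius polynomial `arithFrobPolyOfSatake ι (N w) 1 α = ∏_j (X − ι⁻¹(α_j⁻¹))` is the
characteristic polynomial of the arithmetic Frobenii of `ρ` at `w`.  The two named residual risks of the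
crux (`why it might fail`: "an L- vs C-normalisation or charpoly-uniqueness slip between SatakeFrobCompatibleAt
and Σα⁻¹ = a_w") are exactly the two stubs:

* `stub_frobCharpolyUnique` — **uniqueness of the Frobenius characteristic polynomial** of a framed
  `ℓ`-adic representation of `Γ_K`, `K` a number field, at a finite place `w`:
  `ρ.HasFrobCharpolyAt w P → ρ.HasFrobCharpolyAt w Q → P = Q` (a prime of `\bar ℤ_K` above `w` exists and
  carries an arithmetic Frobenius; Serre 1968, Ch. I §2.1).  No unramifiedness needed (the predicate
  quantifies over ALL arithmetic Frobenii at all `𝔓 ∣ w`).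
* `stub_satakeVieta` — **Vieta for the L-normalised Satake polynomial in rank two, transported along `ι`**:
  if `arithFrobPolyOfSatake ι q 1 α = X² − a X + q` in `ℚ̄_ℓ[X]` (`a ∈ ℤ`, `q ∈ ℕ`) then `Σ_{z ∈ α} z⁻¹ = a`
  and `Π_{z ∈ α} z⁻¹ = q` in `ℂ` (degree count `card α = 2`, elementary symmetric functions of the roots
  `ι⁻¹(z⁻¹)`, and `ι` fixes `ℤ`; Buzzard–Gee 2014, §2.1 / Conj. 3.2.1, arithmetic-Frobenius convention).
* `OrientedOrdinaryOfEngine_of` — the composition, kernel-checked, no `sorry`: destructure the datum,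
  choose `ι`, apply the engine at `k = 2` (the datum's local clause IS the engine's with `k = 2`, exponent
  `(2 - 1) * m` verbatim), intersect the two cofinite filters, unpack `SatakeFrobCompatibleAt`, uniqueness,
  Vieta; concludes the route decl BY NAME.

Both stubs are PROVED in the tree already (route `SkinnerWilesDefectOne`, file
`Theorems/SkinnerWilesDefectOneFiveIsogenyEllipticCurvesSatake.lean`:
`FiveIsogenyEllipticCurves.framed_hasFrobCharpolyAt_unique`,
`FiveIsogenyEllipticCurves.sum_prod_inv_of_arithFrobPolyOfSatake_eq`), so the line is executable at once:
a prover imports that file, closes each stub by `exact`, and proposes this skeleton sorry-free with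
`--workitem stmt-Langlands-16056`.  They are kept as `sorry` stubs here because this is the REGISTRATION of
the line (BC3), not its proof.  Neither stub gives the crux or the summit cheaply (BC3 probes in the seat
folder, `bc/probe_<stub>_to_{crux,summit}.lean`, importing the route file only, stub text verbatim, no sorried
theorem in scope: `first | exact? | simpa [Stub] | (unfold Stub; simpa) | aesop` at `maxHeartbeats 400000` FAILS
4/4 — rc 1, unsolved `a : Stub ⊢ OrientedOrdinaryOfEngine` resp. `⊢ Langlands`, aesop exhaustive-search failure).

Disproof used: none on file (`ledger crux ls stmt-Langlands-16056`: no workfiles, no `Disproof.lean`, no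
`Negative/` lemmas, 2026-08-17).  The crux's antecedent `ReducibleOrdinaryModular` is a separate crux
(stmt-Langlands-12918) and enters only as the hypothesis it literally is — nothing of the engine is assumed
inside a stub.

Shape (for `ledger skeleton check`): stubs `theorem stub_<name> … := by sorry` over tree declarations only
(`FramedGaloisRep.HasFrobCharpolyAt`, `arithFrobPolyOfSatake`, Mathlib `Polynomial.X/C`, `Multiset`);
`_Goal.stub_<name> : Prop := type_of% @stub_<name>` names each statement; the composition
`OrientedOrdinaryOfEngine_of (h₁ : _Goal.stub_frobCharpolyUnique) (h₂ : _Goal.stub_satakeVieta) :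
OrientedOrdinaryOfEngine` is proved without `sorry` (axioms propext / Classical.choice / Quot.sound + the
two stubs' `sorryAx` only through the final `example`).
-/

set_option linter.dupNamespace false
set_option linter.unusedVariables false

noncomputable section

namespace Summit.Langlands.Langlands.Cruxes.OrientedOrdinaryOfEngine.Birth

open Summit.Langlands Summit.Langlands.Langlands.Theses.FifteenLocusEisenstein
open Literature.NumberTheory.Automorphic Literature.NumberTheory.GaloisRepresentations
open NumberField IsDedekindDomain Polynomial Filter
open scoped NumberField Classical

/-! ## 1. The two stubs -/

/-- **STUB 1 — uniqueness of the Frobenius characteristic polynomial of a framed representation** over a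
number field `K`: if every arithmetic Frobenius at every prime above `w` has characteristic polynomial `P`
on `ρ : Γ_K → GL_n(ℚ̄_ℓ)`, and also `Q`, then `P = Q` — because SOME prime of `\bar ℤ_K` lies above `w`
(`HeightOneSpectrum.primesAbove_nonempty`) and carries an arithmetic Frobenius
(`exists_isArithFrobAt_of_mem_primesAbove`).  This is what lets the engine's Satake clause
`HasFrobCharpolyAt w (arithFrobPolyOfSatake ι (N w) 1 α)` be compared with the Tate frame's clause
`HasFrobCharpolyAt w (X² − a_w X + N w)` at the cofinitely many `w` where both hold.  Size S–M; proved in the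
tree as `FiveIsogenyEllipticCurves.framed_hasFrobCharpolyAt_unique` (any `n`, `ℓ`, `K`).
[cite: SerreAbelianLadic1968, Ch. I §2.1] -/
theorem stub_frobCharpolyUnique {K : Type} [Field K] [NumberField K] {ℓ : ℕ} [Fact ℓ.Prime] {n : ℕ}
    {ρ : FramedGaloisRep K (PadicAlgCl ℓ) n} {w : HeightOneSpectrum (𝓞 K)} {P Q : (PadicAlgCl ℓ)[X]}
    (hP : ρ.HasFrobCharpolyAt w P) (hQ : ρ.HasFrobCharpolyAt w Q) : P = Q := by
  sorry

/-- **STUB 2 — Vieta for the L-normalised Satake polynomial in rank two, transported along `ι`.**  If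
`arithFrobPolyOfSatake ι q 1 α = ∏_{z ∈ α} (X − ι⁻¹(z⁻¹))` equals `X² − a X + q` in `ℚ̄_ℓ[X]` (`a ∈ ℤ`,
`q ∈ ℕ`), then `Σ_{z ∈ α} z⁻¹ = a` and `Π_{z ∈ α} z⁻¹ = q` in `ℂ`: `α` has two entries (degree count), the
roots `ι⁻¹(z⁻¹)` have elementary symmetric functions `a` and `q`, and `ι` carries them back to `ℂ` fixing
`ℤ`.  This is the L- vs C-normalisation bookkeeping of the crux (arithmetic-Frobenius eigenvalues `α_j⁻¹`,
`m = 1`, no half-twist).  Size M; proved in the tree as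
`FiveIsogenyEllipticCurves.sum_prod_inv_of_arithFrobPolyOfSatake_eq`.
[cite: BuzzardGeeLMS2014, §2.1 and Conj. 3.2.1] -/
theorem stub_satakeVieta {ℓ : ℕ} [Fact ℓ.Prime] (ι : PadicAlgCl ℓ ≃+* ℂ) {q : ℕ} {a : ℤ}
    {α : Multiset ℂ}
    (h : arithFrobPolyOfSatake ι q 1 α = X ^ 2 - C (a : PadicAlgCl ℓ) * X + C (q : PadicAlgCl ℓ)) :
    (α.map fun z => z⁻¹).sum = (a : ℂ) ∧ (α.map fun z => z⁻¹).prod = (q : ℂ) := by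
  sorry

/-! ## 2. The stub statements as named `Prop`s (literally their types) -/

namespace _Goal

/-- The statement of `stub_frobCharpolyUnique`, as a named `Prop` (literally its type). [folklore] -/
def stub_frobCharpolyUnique : Prop :=
  type_of% @Summit.Langlands.Langlands.Cruxes.OrientedOrdinaryOfEngine.Birth.stub_frobCharpolyUnique

/-- The statement of `stub_satakeVieta`, as a named `Prop` (literally its type). [folklore] -/
def stub_satakeVieta : Prop :=
  type_of% @Summit.Langlands.Langlands.Cruxes.OrientedOrdinaryOfEngine.Birth.stub_satakeVieta

end _Goal

/-- The two named statements, written out (definitional). [folklore] -/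
theorem goals_iff :
    (_Goal.stub_frobCharpolyUnique ↔
      ∀ {K : Type} [Field K] [NumberField K] {ℓ : ℕ} [Fact ℓ.Prime] {n : ℕ}
        {ρ : FramedGaloisRep K (PadicAlgCl ℓ) n} {w : HeightOneSpectrum (𝓞 K)} {P Q : (PadicAlgCl ℓ)[X]},
        ρ.HasFrobCharpolyAt w P → ρ.HasFrobCharpolyAt w Q → P = Q) ∧
    (_Goal.stub_satakeVieta ↔
      ∀ {ℓ : ℕ} [Fact ℓ.Prime] (ι : PadicAlgCl ℓ ≃+* ℂ) {q : ℕ} {a : ℤ} {α : Multiset ℂ},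
        arithFrobPolyOfSatake ι q 1 α = X ^ 2 - C (a : PadicAlgCl ℓ) * X + C (q : PadicAlgCl ℓ) →
        (α.map fun z => z⁻¹).sum = (a : ℂ) ∧ (α.map fun z => z⁻¹).prod = (q : ℂ)) :=
  ⟨Iff.rfl, Iff.rfl⟩

/-! ## 3. The pointwise transport: Satake–Frobenius compatibility + Tate-frame charpoly ⇒ point counts -/

/-- **From `SatakeFrobCompatibleAt` to the lang.S28 trace/norm identities** (from the two stubs): if `π`
and `ρ : Γ_K → GL₂(ℚ̄_ℓ)` are Satake–Frobenius compatible at `w` and the arithmetic Frobenii at `w` have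
characteristic polynomial `X² − a X + N w` on `ρ` (`a ∈ ℤ`), then `π` has a Satake parameter `α` at `w`
with `Σ z⁻¹ = a`, `Π z⁻¹ = N w`. [cite: BuzzardGeeLMS2014, Conj. 3.2.1] -/
theorem pointCount_of_satakeFrobCompatibleAt (h₁ : _Goal.stub_frobCharpolyUnique)
    (h₂ : _Goal.stub_satakeVieta) {K : Type} [Field K] [NumberField K] {ℓ : ℕ} [Fact ℓ.Prime]
    {hcpt : isCompact_glFiniteIntegralLevel 2 K} {ι : PadicAlgCl ℓ ≃+* ℂ}
    {πA : AutomorphicRepData (AutomorphyDatum.gl 2 K hcpt)} {ρ : FramedGaloisRep K (PadicAlgCl ℓ) 2}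
    {w : HeightOneSpectrum (𝓞 K)} (h : SatakeFrobCompatibleAt ι πA ρ w) {a : ℤ}
    (hP : ρ.HasFrobCharpolyAt w
      (X ^ 2 - C (a : PadicAlgCl ℓ) * X + C ((w.residueCard : ℕ) : PadicAlgCl ℓ))) :
    ∃ α : Multiset ℂ, πA.HasSatakeParamAt w α ∧
      (α.map fun z => z⁻¹).sum = (a : ℂ) ∧ (α.map fun z => z⁻¹).prod = ((w.residueCard : ℕ) : ℂ) := by
  have hU : type_of% @stub_frobCharpolyUnique := h₁
  have hV : type_of% @stub_satakeVieta := h₂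
  obtain ⟨α, hα, -, hρ⟩ := h
  -- the two Frobenius characteristic polynomials of `ρ` at `w` coincide (STUB 1) …
  have heq : arithFrobPolyOfSatake ι w.residueCard 1 α =
      X ^ 2 - C (a : PadicAlgCl ℓ) * X + C ((w.residueCard : ℕ) : PadicAlgCl ℓ) := hU hρ hP
  -- … and Vieta for the L-normalised Satake polynomial, transported along `ι` (STUB 2)
  exact ⟨α, hα, hV ι heq⟩

/-! ## 4. The composition (kernel-checked, no `sorry`): ENGINE at `k = 2` → transport → the crux by name -/

/-- **`OrientedOrdinaryOfEngine` from the two stubs.**  Given the engine `ReducibleOrdinaryModular` (the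
crux's own antecedent), `F` imaginary quadratic, `p ≠ 2`, `E/𝓞_F` with `Δ ≠ 0` and no geometric CM, and a
Skinner–Wiles datum `(O, ρ, ρ₀, m)`: choose `ι : ℚ̄_p ≃+* ℂ` (Steinitz, tree theorem
`PadicAlgCl.nonempty_ringEquiv_complex`), apply the engine to `(ρ, ρ₀)` with `k = 2` — irreducibility and
a.e.-unramifiedness are clauses of the datum, and the datum's local clause is the engine's with `k = 2`
verbatim — to get an L-algebraic cuspidal `π` with `SatakeFrobCompatibleAt ι π ρ w` for cofinitely many `w`;
on the intersection with the cofinite set where the frame's charpoly clause holds,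
`pointCount_of_satakeFrobCompatibleAt` gives `Σ α⁻¹ = a_w(E)`, `Π α⁻¹ = N w`.  Hypotheses are, by name, the
statements of `stub_frobCharpolyUnique` and `stub_satakeVieta`; the conclusion is the route decl
`Summit.Langlands.Langlands.Theses.FifteenLocusEisenstein.OrientedOrdinaryOfEngine`.
[cite: SkinnerWiles1999, Thm. A] [cite: BuzzardGeeLMS2014, Conj. 3.2.1] -/
theorem OrientedOrdinaryOfEngine_of (h₁ : _Goal.stub_frobCharpolyUnique) (h₂ : _Goal.stub_satakeVieta) :
    Summit.Langlands.Langlands.Theses.FifteenLocusEisenstein.OrientedOrdinaryOfEngine := by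
  intro hE F _ _ htc hdeg p _ hp E hΔ hcm hdat hcpt
  -- the Skinner–Wiles datum of `E` at `p`
  obtain ⟨O, ρ, ρ₀, hO, ⟨hirr, hfrob⟩, hmod, m, hm, hloc⟩ := hdat
  -- any field isomorphism `ℚ̄_p ≃ ℂ` (Steinitz; proved in the tree)
  obtain ⟨ι⟩ := PadicAlgCl.nonempty_ringEquiv_complex p
  -- the engine at parallel weight `k = 2`
  obtain ⟨π, hLalg, hSat⟩ := hE F htc hdeg p hp O hO hcpt ι ρ ρ₀ hirr
    (hfrob.mono fun w hw => hw.1) hmod ⟨2, le_rfl, m, hm, hloc⟩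
  refine ⟨π, hLalg, ?_⟩
  -- at the cofinitely many `w` where both the Satake clause and the frame's charpoly clause hold
  filter_upwards [hSat, hfrob] with w hw₁ hw₂
  exact pointCount_of_satakeFrobCompatibleAt h₁ h₂ hw₁ hw₂.2

/-- By-name sanity check (an `example`, not a declaration of the file): the two stubs feed the
composition as they stand. -/
example : Summit.Langlands.Langlands.Theses.FifteenLocusEisenstein.OrientedOrdinaryOfEngine :=
  OrientedOrdinaryOfEngine_of @stub_frobCharpolyUnique @stub_satakeVieta

end Summit.Langlands.Langlands.Cruxes.OrientedOrdinaryOfEngine.Birth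

end
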